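import Summits.CriticalPhenomena.PercolationContinuityZ3.Theorems.Transplant.SitePreFKGSurplus
import Summits.CriticalPhenomena.PercolationContinuityZ3.Theorems.Transplant.SiteCSHTheoremOne
import HarnessLib

/-!
# SITE percolation: Kozma–Nitzan's pre-FKG CONJECTURE 4 and CONJECTURE 2 for EVERY relay set, on every finite graph with
# non-degenerate vertex weights — unconditionally (site twin of `Theorems/PercNearOneGluingNoHeavyLowerTailKNConj4OfCSH.lean`,
# prim-ineq-gen-6; lane `prim-bschramm` C1a, prover `prim-hp-8` gen 17 — file 3/3 of the SITE Conjecture 4 / 2 transplant)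

builds on p205010 (kernel theorem, internal audit signed; external expert review pending).

Kozma–Nitzan, arXiv:2401.12397, CONJECTURE 4 (p. 32), stated there for bond percolation; SITE model here (convention A): for every
monotone cluster property `F`, every relay set `A ≠ ∅` and every `o`, some `a ∈ A` (any relay of least mean, or `o` itself if `o ∈ A`)
has `E[F(C_a); o ↔ A] ≤ E[F(C_o); o ↔ A]`.  Proof = the bond assembly verbatim on the site data: peel one relay `k ≠ c`
(`SitePreFKG.preSurplus_erase_add`); site vdBHK Thm 1.3 (`SiteBHK.siteClusterCondPosAssoc`, p1) for `C_k` given `k ↮ A∖k` with the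
projected functional (`SitePreFKG.setIntegral_sub_eq_projFun`) gives `μ(D_k)·T_k(o) ≥ μ(D_k ∩ {k↔o})·((m_k − m_c) − Δ_k(A∖k))`, and the
two-observer site pre-FKG margin at `D = []` (`SitePreFKG.preMargin_nonneg_of_siteCSH`) gives `μ(D_k)·Δ_o(A∖k) ≥ μ(D_k ∩ {k↔o})·Δ_k(A∖k)`; add.
* `SitePreFKG.siteKN_conj4_of_siteCSH` — from the site conditioned slack hierarchy (hypothesis `hCSH`);
* **`SitePreFKG.siteKN_conj4_holds`** — UNCONDITIONAL, via `SiteCSH.siteCSHAll_holds` (p215077) (OURS; new for the site model);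
* **`SitePreFKG.siteKN_conj2_holds`** — SITE Conjecture 2 / pre-FKG display (3): `∃ a ∈ A, P(a ↔ b, o ↔ A) ≤ P(o ↔ b, o ↔ A)`, every `|A|`;
* `SitePreFKG.siteKN_conj4_min` — the printed `min` form with `Finset.inf'`.
-- TODO(general form): vertex weights in `[0,1]` (closure over degenerate weights by continuity, as bond `…KNConj4AllWeights.lean`).
Support file (`--supports stmt-CriticalPhenomena-4575 --as helper`); no definitions, no named facts, no sorries.
[cite: KozmaNitzan2024, Conj. 4 and Thms. 7–9 (p. 32), Conj. 2 / display (3) (p. 3), Question 7 (p. 36)] [cite: VandenbergHaggstromKahn2005, Thm. 1.3 (p. 6), §2.1 Lemma 2.4 (p. 10)]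
-/

noncomputable section

namespace Summit.CriticalPhenomena.PercolationContinuityZ3.Theorems.Transplant

namespace SitePreFKG

open MeasureTheory Set Literature.Probability.LatticeModels Literature.Probability.Percolation
open Summit.CriticalPhenomena.PercolationContinuityZ3.Theorems.CSH (cshMarg cshMarg_nil)
open Summit.CriticalPhenomena.PercolationContinuityZ3.Theorems.SiteTransplant (siteConn mem_siteConn)
open SiteGen (mem_siteConn_iff_mem_siteCluster siteCluster_eq_of_mem siteConn_comm)
open SiteBHK2 (bar)
open SiteBHK (siteClusterCondPosAssoc)
open SiteCSH (avoidConst decoyList obsConst covD cshMargin SiteCSHHolds SiteCSHAll siteCSHAll_holds)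
open scoped Classical

variable {n : ℕ} {Γ : SimpleGraph (Fin n)}

/-- **Site Kozma–Nitzan Conjecture 4 (pre-FKG) for EVERY relay set, from the site conditioned slack hierarchy.**  Non-degenerate vertex
weights; `hCSH` = site Theorem 1 for every owner, avoided set, decoy list and observer pair with distinct named vertices.  Then for every
`A ≠ ∅`, every `o` and every monotone `F`, some `a ∈ A` has `E[F(C_a); o ↔ A] ≤ E[F(C_o); o ↔ A]` (site connections).
[cite: KozmaNitzan2024, Conj. 4 (p. 32)] [cite: VandenbergHaggstromKahn2005, Thm. 1.3 (p. 6), §2.1 Lemma 2.4 (p. 10)] -/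
theorem siteKN_conj4_of_siteCSH (q : Fin n → unitInterval) (hq : ∀ v, 0 < q v ∧ q v < 1)
    (hCSH : ∀ (o v x : Fin n) (Y : Finset (Fin n)) (D : List (Fin n)),
      o ≠ v → x ∉ Y → o ≠ x → v ≠ x → o ∉ Y → v ∉ Y → D.Nodup → (∀ d ∈ D, d ≠ x ∧ d ∉ Y ∧ d ≠ o ∧ d ≠ v) →
      SiteCSHHolds Γ q x (↑Y : Set (Fin n)) D o v)
    (A : Finset (Fin n)) (o : Fin n) (F : Set (Fin n) → ℝ) (hF : ∀ S T : Set (Fin n), S ⊆ T → F S ≤ F T) (hA : A.Nonempty) :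
    ∃ a ∈ A, ∫ ω in ⋃ a' ∈ A, siteConn Γ o a', F (siteCluster Γ ω a) ∂(prodBernoulli q) ≤
      ∫ ω in ⋃ a' ∈ A, siteConn Γ o a', F (siteCluster Γ ω o) ∂(prodBernoulli q) := by
  set μ := prodBernoulli q with hμ
  have hmeas : ∀ S : Set (Set (Fin n)), MeasurableSet S := fun _ => MeasurableSet.of_discrete
  have hint : ∀ (g : Set (Fin n) → ℝ), Integrable g μ := fun g => Integrable.of_finite
  by_cases hoA : o ∈ A
  · exact ⟨o, hoA, le_rfl⟩
  obtain ⟨c, hcA, hcmin⟩ := Finset.exists_min_image A (fun u => ∫ ω, F (siteCluster Γ ω u) ∂μ) hA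
  refine ⟨c, hcA, ?_⟩
  -- it suffices that `Δ_o(A) ≥ 0`
  suffices hΔ : 0 ≤ ∫ ω in ⋃ a' ∈ A, siteConn Γ o a', (F (siteCluster Γ ω o) - F (siteCluster Γ ω c)) ∂μ by
    rw [integral_sub (hint _).integrableOn (hint _).integrableOn] at hΔ
    linarith
  have main : ∀ (X : Finset (Fin n)), X ⊆ A → c ∈ X →
      0 ≤ ∫ ω in ⋃ a' ∈ X, siteConn Γ o a', (F (siteCluster Γ ω o) - F (siteCluster Γ ω c)) ∂μ := by
    intro X hXA hcX
    have hoX : o ∉ X := fun h => hoA (hXA h)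
    rcases (X.erase c).eq_empty_or_nonempty with h0 | hne
    · have hXc : X = {c} := by rw [← Finset.insert_erase hcX, h0]; rfl
      rw [hXc]
      have hU : (⋃ a ∈ ({c} : Finset (Fin n)), (siteConn Γ o a : Set (Set (Fin n)))) = siteConn Γ o c := by ext ω; simp
      rw [hU, setIntegral_congr_fun (hmeas _) (g := fun _ => (0 : ℝ)) (fun ω hω => by
        show F (siteCluster Γ ω o) - F (siteCluster Γ ω c) = 0
        rw [siteCluster_eq_of_mem Γ ((mem_siteConn_iff_mem_siteCluster Γ o c ω).1 hω), sub_self])]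
      simp
    obtain ⟨k, hk⟩ := hne
    have hkc : k ≠ c := (Finset.mem_erase.1 hk).1
    have hkX : k ∈ X := (Finset.mem_erase.1 hk).2
    set X' : Finset (Fin n) := X.erase k with hX'
    have hX'X : ∀ a ∈ X', a ∈ X := fun a ha => Finset.mem_of_mem_erase ha
    have hkX' : k ∉ X' := Finset.notMem_erase k X
    have hcX' : c ∈ X' := Finset.mem_erase.2 ⟨hkc.symm, hcX⟩
    have hko : o ≠ k := fun h => hoX (h ▸ hkX)
    have hmk : ∫ ω, F (siteCluster Γ ω c) ∂μ ≤ ∫ ω, F (siteCluster Γ ω k) ∂μ := hcmin k (hXA hkX)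
    set Dk : Set (Set (Fin n)) := {ω : Set (Fin n) | ∀ a ∈ (↑X' : Set (Fin n)), a ∉ siteCluster Γ ω k} with hDk
    set gk : Set (Fin n) → ℝ := fun ω => F (siteCluster Γ ω k) - F (siteCluster Γ ω c) with hgk
    set Gk : Set (Fin n) → ℝ := fun K => F K - ∫ η, F (siteCluster Γ (η \ bar Γ k K) c) ∂μ with hGk
    have hGk_mono : Monotone Gk := monotone_projFun q c k F hF
    set Δo : ℝ := ∫ ω in ⋃ a' ∈ X', siteConn Γ o a', (F (siteCluster Γ ω o) - F (siteCluster Γ ω c)) ∂μ with hΔo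
    set Δk : ℝ := ∫ ω in ⋃ a' ∈ X', siteConn Γ k a', (F (siteCluster Γ ω k) - F (siteCluster Γ ω c)) ∂μ with hΔk
    set Tko : ℝ := ∫ ω in Dk ∩ siteConn Γ k o, gk ω ∂μ with hTko
    set J : ℝ := ∫ ω in Dk, gk ω ∂μ with hJ
    set M : ℝ := μ.real Dk with hM
    set E : ℝ := μ.real (Dk ∩ siteConn Γ k o) with hE
    -- peel
    have hpeel : ∫ ω in ⋃ a' ∈ X, siteConn Γ o a', (F (siteCluster Γ ω o) - F (siteCluster Γ ω c)) ∂μ = Δo + Tko := by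
      rw [hΔo, hTko, hgk]
      exact preSurplus_erase_add q X F c k o hkX
    -- tower identities
    have hDk_S : ∀ u : Fin n, Dk ∩ siteConn Γ k u =
        {ω : Set (Fin n) | c ∉ siteCluster Γ ω k} ∩
          {ω | siteCluster Γ ω k ∈ {K : Set (Fin n) | (∀ a ∈ X', a ≠ c → a ∉ K) ∧ u ∈ K}} := by
      intro u; ext ω
      simp only [mem_inter_iff, hDk, mem_setOf_eq, Finset.mem_coe]
      constructor
      · rintro ⟨h1, h2⟩
        exact ⟨h1 c hcX', fun a ha _ => h1 a ha, (mem_siteConn_iff_mem_siteCluster Γ k u ω).1 h2⟩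
      · rintro ⟨h1, h2, h3⟩
        refine ⟨fun a ha => ?_, (mem_siteConn_iff_mem_siteCluster Γ k u ω).2 h3⟩
        by_cases hac : a = c
        · rw [hac]; exact h1
        · exact h2 a ha hac
    have hDk_0 : Dk = {ω : Set (Fin n) | c ∉ siteCluster Γ ω k} ∩
          {ω | siteCluster Γ ω k ∈ {K : Set (Fin n) | ∀ a ∈ X', a ≠ c → a ∉ K}} := by
      ext ω
      simp only [mem_inter_iff, hDk, mem_setOf_eq, Finset.mem_coe]
      constructor
      · intro h1
        exact ⟨h1 c hcX', fun a ha _ => h1 a ha⟩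
      · rintro ⟨h1, h2⟩ a ha
        by_cases hac : a = c
        · rw [hac]; exact h1
        · exact h2 a ha hac
    have towO : Tko = ∫ ω in Dk ∩ siteConn Γ k o, Gk (siteCluster Γ ω k) ∂μ := by
      simp only [hTko, hgk]; rw [hDk_S o]; exact setIntegral_sub_eq_projFun q c k F _
    have tow0 : J = ∫ ω in Dk, Gk (siteCluster Γ ω k) ∂μ := by
      simp only [hJ, hgk]; rw [hDk_0]; exact setIntegral_sub_eq_projFun q c k F _
    have hJtot : J = ((∫ ω, F (siteCluster Γ ω k) ∂μ) - ∫ ω, F (siteCluster Γ ω c) ∂μ) - Δk := by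
      have h1 := integral_add_compl (hmeas Dk) (hint gk)
      have hDkc : Dkᶜ = ⋃ a' ∈ X', (siteConn Γ k a' : Set (Set (Fin n))) := by
        ext ω
        rw [mem_iUnion_siteConn, mem_compl_iff, hDk]
        simp only [mem_setOf_eq, Finset.mem_coe, not_forall, not_not, exists_prop]
      have h2 : ∫ ω in Dkᶜ, gk ω ∂μ = Δk := by
        rw [hDkc]
      have h3 : ∫ ω, gk ω ∂μ = (∫ ω, F (siteCluster Γ ω k) ∂μ) - ∫ ω, F (siteCluster Γ ω c) ∂μ := by
        rw [hgk, integral_sub (hint _) (hint _)]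
      rw [hJ]; linarith
    -- one-cluster positive association for the SITE cluster `C_k` given `k ↮ X'` (site vdBHK Thm 1.3):  `M·Tko ≥ J·E`
    set Go : Set (Fin n) → ℝ := fun K => if o ∈ K then 1 else 0 with hGo
    have hGo_mono : Monotone Go := by
      intro K K' hKK'
      simp only [hGo]
      by_cases h1 : o ∈ K
      · rw [if_pos h1, if_pos (hKK' h1)]
      · rw [if_neg h1]; split_ifs <;> norm_num
    have hPA := siteClusterCondPosAssoc (Γ := Γ) q k (↑X' : Set (Fin n)) Gk Go hGk_mono hGo_mono
    have hind : (fun ω : Set (Fin n) => Go (siteCluster Γ ω k)) = (siteConn Γ k o : Set (Set (Fin n))).indicator 1 := by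
      funext ω
      simp only [hGo]
      by_cases h : ω ∈ siteConn Γ k o
      · rw [indicator_of_mem h, Pi.one_apply, if_pos ((mem_siteConn_iff_mem_siteCluster Γ k o ω).1 h)]
      · rw [indicator_of_notMem h, if_neg (fun h' => h ((mem_siteConn_iff_mem_siteCluster Γ k o ω).2 h'))]
    have hI1 : ∫ ω in Dk, Go (siteCluster Γ ω k) ∂μ = E := by
      rw [show (fun ω => Go (siteCluster Γ ω k)) = (siteConn Γ k o : Set (Set (Fin n))).indicator 1 from hind,
        setIntegral_indicator (hmeas _)]
      simp only [Pi.one_apply, setIntegral_const, smul_eq_mul, mul_one, hE]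
    have hI2 : ∫ ω in Dk, Gk (siteCluster Γ ω k) * Go (siteCluster Γ ω k) ∂μ = ∫ ω in Dk ∩ siteConn Γ k o, Gk (siteCluster Γ ω k) ∂μ := by
      have e : (fun ω : Set (Fin n) => Gk (siteCluster Γ ω k) * Go (siteCluster Γ ω k)) =
          (siteConn Γ k o : Set (Set (Fin n))).indicator (fun ω => Gk (siteCluster Γ ω k)) := by
        funext ω
        have hω : Go (siteCluster Γ ω k) = (siteConn Γ k o : Set (Set (Fin n))).indicator 1 ω := congrFun hind ω
        rw [hω]
        by_cases h : ω ∈ siteConn Γ k o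
        · rw [indicator_of_mem h, indicator_of_mem h, Pi.one_apply, mul_one]
        · rw [indicator_of_notMem h, indicator_of_notMem h, mul_zero]
      rw [e, setIntegral_indicator (hmeas _)]
    have hC : J * E ≤ M * Tko := by
      have h := hPA
      rw [hI1, hI2, ← tow0, ← towO] at h
      simpa [hM, hDk] using h
    -- the two-observer site margin at `D = []`, observers `(o, k)`:  `Δo − (E/M)·Δk ≥ 0`
    have hpm := preMargin_nonneg_of_siteCSH q hq o k
      (fun x Y D hxY hox hkx hoY hkY hD hDd => hCSH o k x Y D hko hxY hox hkx hoY hkY hD hDd)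
      X' c [] F hF hcX' (fun a ha => hcmin a (hXA (hX'X a ha))) (fun h => hoX (hX'X o h)) hkX' List.nodup_nil
      (fun d hd => by simp at hd)
    simp only [decoyList, cshMarg_nil] at hpm
    -- identify the constant `obsConst Γ q o k (↑X' ∪ ∅) = E / M`
    have hset0 : ((↑X' : Set (Fin n)) ∪ {d | d ∈ ([] : List (Fin n))}) = ↑X' := by simp
    have hp0 : obsConst Γ q o k ((↑X' : Set (Fin n)) ∪ {d | d ∈ ([] : List (Fin n))}) = E / M := by
      rw [hset0, obsConst, hE, hM, hDk, siteConn_comm Γ o k]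
    rw [hp0] at hpm
    have hMpos : 0 < M := prodBernoulli_real_pos_of_nonempty hq ⟨∅, fun a _ h => h.1⟩
    have hE0 : 0 ≤ E := measureReal_nonneg
    have hpm' : E * Δk ≤ M * Δo := by
      have : 0 ≤ M * (Δo - E / M * Δk) := mul_nonneg hMpos.le hpm
      have e : M * (Δo - E / M * Δk) = M * Δo - E * Δk := by field_simp
      linarith [this, e]
    -- assemble
    have hmk' : 0 ≤ (∫ ω, F (siteCluster Γ ω k) ∂μ) - ∫ ω, F (siteCluster Γ ω c) ∂μ := by linarith [hmk]
    have hfin : 0 ≤ M * (Δo + Tko) := by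
      have hJE : J * E = ((∫ ω, F (siteCluster Γ ω k) ∂μ) - ∫ ω, F (siteCluster Γ ω c) ∂μ) * E - Δk * E := by rw [hJtot]; ring
      nlinarith [hC, hpm', hJE, mul_nonneg hmk' hE0]
    rw [hpeel]
    exact le_of_mul_le_mul_left (by rw [mul_zero]; exact hfin) hMpos
  exact main A (subset_refl A) hcA

/-- **SITE KOZMA–NITZAN CONJECTURE 4, for every relay set, unconditionally** (OURS): on every finite graph `Γ` with non-degenerate
vertex weights `0 < q < 1`, for every monotone `F` on vertex sets, every `A ≠ ∅` and every `o`, some `a ∈ A` has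
`E[F(C_a); o ↔ A] ≤ E[F(C_o); o ↔ A]` for SITE percolation.  (= `siteKN_conj4_of_siteCSH` with `SiteCSH.siteCSHAll_holds`.)
-- TODO(general form): weights in `[0,1]` (closure over degenerate weights by continuity and finiteness of `A`).
[cite: KozmaNitzan2024, Conj. 4 (p. 32)] -/
theorem siteKN_conj4_holds (Γ : SimpleGraph (Fin n)) (q : Fin n → unitInterval) (hq : ∀ v, 0 < q v ∧ q v < 1)
    (A : Finset (Fin n)) (o : Fin n) (F : Set (Fin n) → ℝ) (hF : ∀ S T : Set (Fin n), S ⊆ T → F S ≤ F T) (hA : A.Nonempty) :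
    ∃ a ∈ A, ∫ ω in ⋃ a' ∈ A, siteConn Γ o a', F (siteCluster Γ ω a) ∂(prodBernoulli q) ≤
      ∫ ω in ⋃ a' ∈ A, siteConn Γ o a', F (siteCluster Γ ω o) ∂(prodBernoulli q) :=
  siteKN_conj4_of_siteCSH q hq (siteCSHAll_holds n Γ q hq) A o F hF hA

/-- **Site Conjecture 4 in the printed `min` form**: `min_{a ∈ A} E[F(C_a); o ↔ A] ≤ E[F(C_o); o ↔ A]` (`Finset.inf'`).
[cite: KozmaNitzan2024, Conj. 4 (p. 32)] -/
theorem siteKN_conj4_min (Γ : SimpleGraph (Fin n)) (q : Fin n → unitInterval) (hq : ∀ v, 0 < q v ∧ q v < 1)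
    (A : Finset (Fin n)) (o : Fin n) (F : Set (Fin n) → ℝ) (hF : ∀ S T : Set (Fin n), S ⊆ T → F S ≤ F T) (hA : A.Nonempty) :
    A.inf' hA (fun a => ∫ ω in ⋃ a' ∈ A, siteConn Γ o a', F (siteCluster Γ ω a) ∂(prodBernoulli q)) ≤
      ∫ ω in ⋃ a' ∈ A, siteConn Γ o a', F (siteCluster Γ ω o) ∂(prodBernoulli q) := by
  obtain ⟨a, ha, h⟩ := siteKN_conj4_holds Γ q hq A o F hF hA
  exact (Finset.inf'_le _ ha).trans h

/-- **SITE KOZMA–NITZAN CONJECTURE 2 (the pre-FKG display (3)), for every relay set, unconditionally** (OURS; non-degenerate vertex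
weights): for every `b`, some `a ∈ A` has `P(a ↔ b, o ↔ A) ≤ P(o ↔ b, o ↔ A)` for site connections — Conjecture 4 for `F = 1{b ∈ ·}`.
[cite: KozmaNitzan2024, Conj. 2 / display (3) (p. 3), p. 32 (sentence after Conjecture 4)] -/
theorem siteKN_conj2_holds (Γ : SimpleGraph (Fin n)) (q : Fin n → unitInterval) (hq : ∀ v, 0 < q v ∧ q v < 1)
    (A : Finset (Fin n)) (o b : Fin n) (hA : A.Nonempty) :
    ∃ a ∈ A, (prodBernoulli q).real (siteConn Γ a b ∩ ⋃ a' ∈ A, siteConn Γ o a') ≤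
      (prodBernoulli q).real (siteConn Γ o b ∩ ⋃ a' ∈ A, siteConn Γ o a') := by
  have hmeas : ∀ S : Set (Set (Fin n)), MeasurableSet S := fun _ => MeasurableSet.of_discrete
  set Fb : Set (Fin n) → ℝ := fun S => if b ∈ S then 1 else 0 with hFb
  have hF : ∀ S T : Set (Fin n), S ⊆ T → Fb S ≤ Fb T := by
    intro S T hST
    simp only [hFb]
    by_cases hS : b ∈ S
    · rw [if_pos hS, if_pos (hST hS)]
    · rw [if_neg hS]; split_ifs <;> norm_num
  -- `∫_{o↔A} 1{b ∈ C_u} = P(u ↔ b, o ↔ A)`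
  have hev : ∀ u : Fin n, ∫ ω in ⋃ a' ∈ A, siteConn Γ o a', Fb (siteCluster Γ ω u) ∂(prodBernoulli q) =
      (prodBernoulli q).real (siteConn Γ u b ∩ ⋃ a' ∈ A, siteConn Γ o a') := by
    intro u
    have e : (fun ω : Set (Fin n) => Fb (siteCluster Γ ω u)) = (siteConn Γ u b : Set (Set (Fin n))).indicator 1 := by
      funext ω
      simp only [hFb]
      by_cases h : ω ∈ siteConn Γ u b
      · rw [indicator_of_mem h, Pi.one_apply, if_pos ((mem_siteConn_iff_mem_siteCluster Γ u b ω).1 h)]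
      · rw [indicator_of_notMem h, if_neg (fun h' => h ((mem_siteConn_iff_mem_siteCluster Γ u b ω).2 h'))]
    rw [e, setIntegral_indicator (hmeas _)]
    simp only [Pi.one_apply, setIntegral_const, smul_eq_mul, mul_one]
    rw [inter_comm]
  obtain ⟨a, ha, h⟩ := siteKN_conj4_holds Γ q hq A o Fb hF hA
  refine ⟨a, ha, ?_⟩
  rwa [hev a, hev o] at h

end SitePreFKG

end Summit.CriticalPhenomena.PercolationContinuityZ3.Theorems.Transplant
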